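import Summits.QuantumFields.YangMills.Theorems.BalabanUVNodesN27AtEpsSmallFieldsEnvelope13CoPH
import Summits.QuantumFields.YangMills.Theorems.BalabanUVNodesN27AtRecord13CoPHHolder

/-!
# BalabanUVNodes ∕ N27 = binder B5 AT THE RECORD — (G)ʰ: THE R-β TWIN OF LEAF G `…N27AtEpsSmallFieldsEnvelope13CoPH` (dag-n27-c g9, p559890) §2: N27 AT THE PRINT's CANONICAL ε-SMALL
# FIELDS `e_{L,α_L}(ε_k²)` WITH THE TRANSPORT OF RECORD, STAGE 13 `CoPH`, N18 IN CLOSED FORM AT θ WITH NO THRESHOLD ∕ TRANSPORT HYPOTHESIS — NOW WITH NODE N16 IN ITS CURRENCY OF RECORD «R-β»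
# (plan g77 N16 PICK; plan g79 W-SEAT-START-LIST v5∕v6 §n27 (W-b) «R-β TWINS OF THE ADMISSIBLE-READING N18-CURRENCY LEAVES … (G) Envelope p559890 … each = the β = 1 file with `h16`'s
# `InEndRegime ∧ LeafSlotAT ↦ InEndRegimeH ∧ LeafSlotHolderAT … β` (39ᴴ), `h19`'s `RatesAt ↦ RatesHolderAt … β` (41ᴴ), base knit XLᶜᵒᵖᴴ ↦ (Q) §2»; plan g79 WORDS-3R № 7)
# (cell `pub-ymgap`, HUMAN RULING D-0062 Track A; director-ym №197 ∕ HUMAN RULING D-0149 width seats; seat `pub-ymgap-dag-n10-w4` g0, released from row n10 to row N27 by plan g79 after its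
# n10 items (D)∕(D′)∕(D″) landed; K3⁷ `SpineGivenEndpointR13SepCoPH` = stmt-QuantumFields-20544, `--kind proof --supports 20544 --as helper`; COUNT-NEUTRAL; THEOREMS ONLY, 0 `def`,
# 0 `sorry`; `N`-generic, regime-generic, NO Theses import — the item-facing face is ONE application of leaf A §4 ∕ XXXVIᶜᵒᵖᴴ at `Rg :=` the item's guard, `N = 2`, as leaf E does for (Q) §3)

THE KIT PATTERN (plan §n27: «slice the TREE parent, swap ONE producer face»; here exactly as dag-n17-w3's (A)ʰ `spine_rec13CCoPHOn_at_readingAdm₁₃CoPH_holder_of_inductiveStep`).  PARENT =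
(G) §2 `spine_rec13CCoPHOn_at_epsSmallFieldsEnvelope₁₃CoPH` (regime home, any `Rg`): every binder VERBATIM — the residual DATA `S gauge hg li ℓ₃ ne2 ne1`, NE1′ `h14`, NE2 `h15`, N18 in
CLOSED FORM at θ at dag-n18-e's CANONICAL ε-small-field tables `(ι·,0) '' {V | PlaqSmall (e_{L,α_L}(ε_k²)) V}` with the transport of record `transportRaw F k (avOfRecord F N (k+1) 0)` and the
HYPOTHESIS-FREE clause `admTransport_plaqEnvelope_alphaL` (`h18`, unfolded by dag-n18-d `n18At_u3OfRecord₁₃_readingAdm_iff` + `mem_image_ofBackgroundC_iff` exactly as in (G)), N22 ⟸ N18 by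
dag-n22-e 8a″ `s_N22_readingOfRecord₁₃CoPHOn_ofRecordAdm_of_s_N18_stripBound` (`hjunk hnum hstrip` — (J), twelve numerals, STRIP-(1.18) VERBATIM), (D4) `hD4`, spine side `h20 h21 hx` — EXCEPT
the two R-β swaps: `h16`'s `InEndRegime ∧ LeafSlotAT` ↦ `InEndRegimeH ∧ LeafSlotHolderAT … β` once per guarded family (dag-n16-e 39ᴴ `s_N16Holder_readingOfRecord₁₃CoPHOn_of_leafSlotHolderAT
hβ0 hβ1`, `0 ≤ β ≤ 1`), and `h19`'s same-tuple N19′ edge reading `RatesAt` ↦ dag-n16-e 41ᴴ's `RatesHolderAt … β`; base knit XLᶜᵒᵖᴴ `spine_rec13CCoPHOn_at_readingOfRecord₁₃CoPH` ↦ (Q) §2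
★ `spine_rec13CCoPHOn_at_readingOfRecord₁₃CoPH_holder cr β w1 ne2 ne1 Rg ℓ₃` (dag-n27-c g10, p581033).  (G), (Q), 39ᴴ, 41ᴴ, 8a″, dag-n18-d∕-e's N18 modules and every landed declaration
UNTOUCHED (additive file); nothing re-declared.

WHAT IS KERNEL-CHECKED ([bookkeeping]; ONE theorem, 0 `def`, 0 `sorry`):
* §1 ★★ `spine_rec13CCoPHOn_at_epsSmallFieldsEnvelope₁₃CoPH_holder` — REGIME HOME, any `Rg` ⇒ `Spine (IsRecordOfRecord₁₃CCoPHOn Rg)` from: NE1′ ∕ NE2 at θ in the regime, N16 AT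
  EXPONENT `β` as `InEndRegimeH ∧ LeafSlotHolderAT … β`, N18 in closed form at the canonical ε-small fields (no threshold ∕ transport hypothesis), N22 eliminated given N18 (STRIP currency),
  N17 eliminated inside (Q) §2, (D4) at θ, N20 ∕ N21 ∕ the spine-side representation displayed, the N19′ edge reading `RatesHolderAt … β`.

HONEST FRAMING.  COMPOSITE-node bookkeeping BY NAME; no estimate of its own.  The (1.18) inequality at the canonical ε-small fields, (J) ∕ STRIP-(1.18), the numerals, NE1′, NE2,
`InEndRegimeH ∧ LeafSlotHolderAT … β`, (D4), NE7b, NE7c, the extraction clause and NE7's core edge are DISPLAYED hypotheses with no producer at the ₁₃ reading today (0∕1; K0⁷ OPEN, no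
`Provisos₁₃CoPH` inhabitant claimed); the thresholds are dag-n18-e's cell choice of Bałaban's `e_{L,α}` (the tables are inhabited by `U ≡ 1`, not a content claim); `β` a LETTER (`0 ≤ β ≤ 1`
here; the consumers' window `2∕3 < β < 1` is theirs); NE3 at exponent β NOT PROVED; nothing of Bałaban's asserted or instantiated; N16 ∕ N18 ∕ N22 ∕ N27 NOT discharged; K3⁷ NOT claimed;
counts UNMOVED (typed 28∕28 · discharged 5∕27, A 5∕28); one finite four-torus programme at fixed `ε` — R4 closes the conditional rung `BalabanLadder.UV` only; NOT ℝ⁴, NOT infinite volume,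
NOT OS, NOT a mass gap, NOT Clay.  General-`N`.  No decl below carries a cite tag.
-/

noncomputable section

namespace Summit.QuantumFields.YangMills.Theorems.BalabanUVNodesN27SpineRecord

open Set Metric
open scoped Matrix.Norms.L2Operator

open Literature.MathematicalPhysics.QuantumFieldTheory.Balaban1983to89
open Literature.MathematicalPhysics.QuantumFieldTheory.Balaban1983to89.T4Continuum
open Literature.MathematicalPhysics.QuantumFieldTheory.Balaban1983to89.T4OutputRate (Carriers Functional NE5 DecayBound Window)
open Literature.MathematicalPhysics.QuantumFieldTheory.Balaban1983to89.TreeLengthTorus (TDom tsys torusTreeLen)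
open Literature.MathematicalPhysics.QuantumFieldTheory.Balaban1983to89.T4InputCauchyRateData (StepModel)
open Literature.MathematicalPhysics.QuantumFieldTheory.Balaban1983to89.B13Resummation (locE)
open Literature.MathematicalPhysics.QuantumFieldTheory.Balaban1983to89.TreeLengthTorusGeometry (TTouch)
open Literature.MathematicalPhysics.QuantumFieldTheory.Balaban1983to89.B12TreeDecay (K₀)
open Summit.QuantumFields.BalabanUV.T4Continuum.Spine.NE5
open YMDAG.N18.HLayer
open YMDAG.N18.W1Reading (s_N18_readingOfRecord₁₃CoPH_plaqEnvelope_iff n18At_u3OfRecord₁₃_readingAdm_iff mem_image_ofBackgroundC_iff admTransport_plaqEnvelope_alphaL)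
open T4ContinuumYM4Torus (ForSmallCouplings)
open Summit.QuantumFields.BalabanUV.T4Continuum.Spine
open YMDAG.UVSplit
open Node00 (Stage13HParams datumOfRecord₁₃CoPH IsRecordOfRecord₁₃CCoPH IsDatumOfRecord₁₃CCoPH NE3Letters₁₁ NE2Objects₁₁ ne3ConstLayerOfRecord₁₁ MatA ιSU prependCoupling)
open Node00.Sect2 (domCount domSys CPair ofBackgroundC)
open Node00.W1 (ReadingData LevelPairing LetterInputs ClusterTower pairOfRecord functionalC termC box SpRestr AdmBg)
open YMDAG.N22 (s_N22_readingOfRecord₁₃CoPH_ofRecordAdm_of_s_N18_analytic s_N22_readingOfRecord₁₃CoPHOn_ofRecordAdm_of_s_N18_stripBound)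
open Summit.QuantumFields.YangMills.BalabanUVNodes.N16Regime (InEndRegime)
open Summit.QuantumFields.YangMills.BalabanUVNodes.N16LeafSlotAllTorus (LeafSlotAT LeafSlotHolderAT)
open Summit.QuantumFields.YangMills.BalabanUVNodes.N16HolderDefs (N16HolderAt S_N16Holder)
open Summit.QuantumFields.YangMills.BalabanUVNodes.SpineRatesHolder (RatesHolderAt)
open Summit.QuantumFields.YangMills.BalabanUVNodes.N16HolderRegime (InEndRegimeH)
open Summit.QuantumFields.YangMills.BalabanUVNodes.N16AtRRec13CoPHLeafSlotAT (s_N16Holder_readingOfRecord₁₃CoPHOn_of_leafSlotHolderAT)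
open Literature.MathematicalPhysics.QuantumFieldTheory.Balaban1983to89.ExpMeanLog (deltaSU)
open Summit.QuantumFields.BalabanUV.T4Continuum.B13Carriers (transportRaw)
open Node00 (avOfRecord)
open Node00.Sect2 (cubeDom)

variable {N : ℕ} [NeZero N] (cr : SpineReading₁₃CoPH N)
  (S : (F : T4Family) → (θ : Stage13HParams F N) → (k : ℕ) → ClusterTower (F.P k) (MatA N) θ.τ9.M)
  (gauge : (F : T4Family) → (θ : Stage13HParams F N) → (k : ℕ) → GaugeField (F.P k) 0 (Node00.SU N) → GaugeField (F.P k) 0 (Node00.SU N) → ℝ)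
  (hg : ∀ (F : T4Family) (θ : Stage13HParams F N) (k : ℕ) (U U' : GaugeField (F.P k) 0 (Node00.SU N)), 0 ≤ gauge F θ k U U')
  (li : (F : T4Family) → Stage13HParams F N → LetterInputs) (ℓ₃ : T4Family → NE3Letters₁₁)
  (ne2 : (F : T4Family) → Stage13HParams F N → (ℕ → ℝ) → List (ULoop F) → ℕ → NE2Objects₁₁)
  (ne1 : (F : T4Family) → Stage13HParams F N → (ℕ → ℝ) → List (ULoop F) → NE1pCarriers)

/-! ## §1 The regime-restricted home at the canonical ε-small fields, any regime `Rg`, N18 in closed form at θ, N16 at exponent `β` -/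

section Regime

variable (Rg : (F : T4Family) → Stage13HParams F N → Prop)

/-- ★★ **N27 = B5 AT THE REGIME RECORD CLASS `IsRecordOfRecord₁₃CCoPHOn F N Rg` FROM THE SLOTS AT THE REGIME HOME OF THE ADMISSIBLE READING AT THE CANONICAL ε-SMALL FIELDS, NODE N16 IN
ITS CURRENCY OF RECORD R-β, ANY `Rg` — N17 ∕ N22 ELIMINATED, N18 IN CLOSED FORM AT θ, NO THRESHOLD ∕ TRANSPORT HYPOTHESIS** ((G) §2 `spine_rec13CCoPHOn_at_epsSmallFieldsEnvelope₁₃CoPH`'s R-β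
twin: base knit (Q) §2 ★ `spine_rec13CCoPHOn_at_readingOfRecord₁₃CoPH_holder` at the admissible `w1 := ReadingData.ofRecordAdm …` read at dag-n18-e's canonical envelope tables with the transport
of record and the hypothesis-free clause `admTransport_plaqEnvelope_alphaL`; N18's θ-level closed form by dag-n18-d's `n18At_u3OfRecord₁₃_readingAdm_iff` + `mem_image_ofBackgroundC_iff`
(the (1.18) inequality for every tuple with provisos IN THE REGIME, admissible, every run length, member, history and run-B field with `|∂U − 1| < e_{L,α_L}(ε_{k+1}²)`) — VERBATIM from (G);
N22 ⟸ that N18 by dag-n22-e 8a″'s regime STRIP edge ((J), twelve numerals, STRIP-(1.18) VERBATIM); NE1′ ∕ NE2 at θ in the regime; N16 AT EXPONENT `β` as `InEndRegimeH ∧ LeafSlotHolderAT … β`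
once per guarded family (dag-n16-e 39ᴴ `s_N16Holder_readingOfRecord₁₃CoPHOn_of_leafSlotHolderAT hβ0 hβ1`, `0 ≤ β ≤ 1`); (D4) at θ; spine side N20 ∕ N21 at `SRec₁₃CoPHOn cr Rg`, the
guarded keyed extraction clause, the same-tuple N19′ edge READING dag-n16-e 41ᴴ's `RatesHolderAt … β`).  At `Rg := Node00.unityNondeg₁₃H 2` ∕ the item's guard, `N = 2` THE ITEM follows by
leaf A §4 ∕ XXXVIᶜᵒᵖᴴ as leaf E does.  Every hypothesis 0∕1 today; NE3 at exponent β NOT PROVED; N16 ∕ N18 ∕ N22 ∕ N27 NOT discharged. [bookkeeping] -/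
theorem spine_rec13CCoPHOn_at_epsSmallFieldsEnvelope₁₃CoPH_holder {β : ℝ} (hβ0 : 0 ≤ β) (hβ1 : β ≤ 1)
    (h14 : ∀ (F : T4Family) (θ : Stage13HParams F N), θ.Provisos₁₃CoPH F N → Rg F θ → θ.Admissible F N → ∀ (g₀ : ℕ → ℝ) (os : List (ULoop F)),
      N14At (ne1 F θ g₀ os))
    (h15 : ∀ (F : T4Family) (θ : Stage13HParams F N), θ.Provisos₁₃CoPH F N → Rg F θ → θ.Admissible F N → ∀ (g₀ : ℕ → ℝ) (os : List (ULoop F)) (k : ℕ),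
      N15At (ne2OfRecord₁₁ (ne2 F θ g₀ os k)))
    (h16 : ∀ (F : T4Family), (∃ θ : Stage13HParams F N, θ.Provisos₁₃CoPH F N ∧ Rg F θ ∧ θ.Admissible F N) →
      InEndRegimeH (ne3OfRecord₁₁ F (ne3ConstLayerOfRecord₁₁ F N (ℓ₃ F))) ∧ LeafSlotHolderAT (ne3OfRecord₁₁ F (ne3ConstLayerOfRecord₁₁ F N (ℓ₃ F))) β)
    -- N18 IN CLOSED FORM AT θ AT THE CANONICAL ε-SMALL FIELDS, asked of the tuples IN THE REGIME (dag-n18-d `n18At_u3OfRecord₁₃_readingAdm_iff` + `mem_image_ofBackgroundC_iff`)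
    (h18 : ∀ (F : T4Family) (θ : Stage13HParams F N), θ.Provisos₁₃CoPH F N → Rg F θ → θ.Admissible F N → ∀ (k : ℕ) (b : ℝ), 0 < b → b ≤ θ.γ →
      ∀ g ∈ Window θ.γ, ∀ (U : GaugeField (F.P (k + 1)) 0 (Node00.SU N)),
        PlaqSmall (min ((F.L : ℝ) ^ 2 * ((F.L : ℝ) ^ 2 - 1) / (4 * (143 * ((16 : ℝ) * (F.L : ℝ) ^ 2) ^ 2))) (deltaSU (Fin N) / 2 / (32 * (F.L : ℝ) ^ 2)) * F.eps (k + 1) ^ 2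
            * (1 + 4 * (143 * ((16 : ℝ) * (F.L : ℝ) ^ 2) ^ 2) * min ((F.L : ℝ) ^ 2 * ((F.L : ℝ) ^ 2 - 1) / (4 * (143 * ((16 : ℝ) * (F.L : ℝ) ^ 2) ^ 2))) (deltaSU (Fin N) / 2 / (32 * (F.L : ℝ) ^ 2))
              / ((F.L : ℝ) ^ 2 * ((F.L : ℝ) ^ 2 - 1)) * F.eps (k + 1) ^ 2)) U →
        ∀ X : Node00.W1.Dom (F.P k) θ.τ9.M,
          |(functionalC (S F θ k) g (ofBackgroundC (ιSU N) (transportRaw F k (avOfRecord F N (k + 1) 0) U)) X).re -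
              (functionalC (S F θ (k + 1)) (prependCoupling b g) (ofBackgroundC (ιSU N) U) (pairOfRecord F θ.τ9.M k X)).re| ≤
            (li F θ).C₅ * (li F θ).θ₅ ^ X.1 * Real.exp (-((li F θ).κ * (domSys (F.P k) θ.τ9.M X.1).dj X.2)))
    -- N22 ⟸ N18 (dag-n22-e module 8a″, STRIP currency on the reading's OWN table, NO readings clause): (J), twelve numerals, STRIP-(1.18) — verbatim
    (hjunk : ∀ (F : T4Family) (θ : Stage13HParams F N), θ.Provisos₁₃CoPH F N → Rg F θ → θ.Admissible F N →
      ∀ (k : ℕ) (X : Node00.W1.Dom (F.P k) θ.τ9.M), k < X.1 → ∀ (g : ℕ → ℝ) (φ : CPair (F.P k) (MatA N)), functionalC (S F θ k) g φ X = 0)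
    (hnum : ∀ (F : T4Family) (θ : Stage13HParams F N), θ.Provisos₁₃CoPH F N → Rg F θ → θ.Admissible F N →
      0 < (li F θ).C₀ ∧ 0 < (li F θ).θ₅ ∧ (li F θ).θ₅ < 1 ∧ 0 ≤ (li F θ).C₅ ∧ 2 * (li F θ).C₅ / (1 - (li F θ).θ₅) ≤ (li F θ).C₀ ∧ 0 < (li F θ).A ∧
        (li F θ).θ₅ ≤ (li F θ).μ ∧ (li F θ).C₀ ≤ 2 * (li F θ).A ∧ 0 < (li F θ).r ∧ 0 < (li F θ).s ∧ (li F θ).s < 1 ∧ 1 ≤ (li F θ).μ)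
    (hstrip : ∀ (F : T4Family) (θ : Stage13HParams F N), θ.Provisos₁₃CoPH F N → Rg F θ → θ.Admissible F N → ∀ (k : ℕ),
      ∀ (j : ℕ) (g : ℕ → ℝ), g ∈ Window θ.γ → ∀ (i : ℕ) (Y : (domSys (F.P k) θ.τ9.M j).Dom) (ψ : CPair (F.P k) (MatA N)), ψ ∈ ofBackgroundC (ιSU N) '' {V : GaugeField (F.P k) 0 (Node00.SU N) |
          PlaqSmall (min ((F.L : ℝ) ^ 2 * ((F.L : ℝ) ^ 2 - 1) / (4 * (143 * ((16 : ℝ) * (F.L : ℝ) ^ 2) ^ 2))) (deltaSU (Fin N) / 2 / (32 * (F.L : ℝ) ^ 2)) * F.eps k ^ 2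
            * (1 + 4 * (143 * ((16 : ℝ) * (F.L : ℝ) ^ 2) ^ 2) * min ((F.L : ℝ) ^ 2 * ((F.L : ℝ) ^ 2 - 1) / (4 * (143 * ((16 : ℝ) * (F.L : ℝ) ^ 2) ^ 2))) (deltaSU (Fin N) / 2 / (32 * (F.L : ℝ) ^ 2))
              / ((F.L : ℝ) ^ 2 * ((F.L : ℝ) ^ 2 - 1)) * F.eps k ^ 2)) V} →
        ∃ (Ec : ℂ → ℂ) (O : Set ℂ), IsOpen O ∧ (∀ t ∈ Ioc (0 : ℝ) θ.γ, closedBall (t : ℂ) (li F θ).r ⊆ O) ∧ DifferentiableOn ℂ Ec O ∧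
          (∀ z ∈ O, ‖Ec z‖ ≤ (li F θ).A * Real.exp (-((li F θ).κ * torusTreeLen Y.1))) ∧
          (∀ t ∈ Ioc (0 : ℝ) θ.γ, Ec t = termC (S F θ k) j Y (Function.update g i t) ψ))
    (hD4 : ∀ (F : T4Family) (θ : Stage13HParams F N) (hP : θ.Provisos₁₃CoPH F N), Rg F θ → θ.Admissible F N → ∀ k : ℕ,
      ReadOutAt (datumOfRecord₁₃CoPH F N θ hP) (u3OfRecord₁₃ θ.toStage13Params
        ((ReadingData.ofRecordAdm F θ.τ9.M N (S F θ) (fun (k j : ℕ) (_ : (domSys (F.P k) θ.τ9.M j).Dom) => ofBackgroundC (ιSU N) '' {V : GaugeField (F.P k) 0 (Node00.SU N) |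
          PlaqSmall (min ((F.L : ℝ) ^ 2 * ((F.L : ℝ) ^ 2 - 1) / (4 * (143 * ((16 : ℝ) * (F.L : ℝ) ^ 2) ^ 2))) (deltaSU (Fin N) / 2 / (32 * (F.L : ℝ) ^ 2)) * F.eps k ^ 2
            * (1 + 4 * (143 * ((16 : ℝ) * (F.L : ℝ) ^ 2) ^ 2) * min ((F.L : ℝ) ^ 2 * ((F.L : ℝ) ^ 2 - 1) / (4 * (143 * ((16 : ℝ) * (F.L : ℝ) ^ 2) ^ 2))) (deltaSU (Fin N) / 2 / (32 * (F.L : ℝ) ^ 2))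
              / ((F.L : ℝ) ^ 2 * ((F.L : ℝ) ^ 2 - 1)) * F.eps k ^ 2)) V})
        (gauge F θ) (hg F θ) (fun k => transportRaw F k (avOfRecord F N (k + 1) 0)) (admTransport_plaqEnvelope_alphaL F θ.toStage13Params.toStage12Params) (li F θ)).u3Objects θ.γ) k))
    (h20 : S_N20 (SRec₁₃CoPHOn cr Rg)) (h21 : S_N21 (SRec₁₃CoPHOn cr Rg))
    (hx : ∀ (F : T4Family) (θ : Stage13HParams F N) (hP : θ.Provisos₁₃CoPH F N), Rg F θ → θ.Admissible F N →
      B16.EndStatementBPrinted (datumOfRecord₁₃CoPH F N θ hP).C → DagBinding.EndpointExistence (datumOfRecord₁₃CoPH F N θ hP).C.toB12 →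
        ForSmallCouplings (datumOfRecord₁₃CoPH F N θ hP) fun g₀ => ∀ os : List (ULoop F),
          0 < (cr F θ hP g₀ os).l₀ ∧ 0 < (cr F θ hP g₀ os).vol ∧
          (∀ (K : ℕ) (t : ℝ), |t| ≤ (cr F θ hP g₀ os).l₀ →
            T4GenFunBounds.schemeZ ((datumOfRecord₁₃CoPH F N θ hP).scheme g₀) os ((cr F θ hP g₀ os).K₀ + K) t =
              ∑ τ ∈ (cr F θ hP g₀ os).T K, (cr F θ hP g₀ os).A K t τ) ∧
          (∀ (K : ℕ) (t : ℝ), |t| ≤ (cr F θ hP g₀ os).l₀ →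
            T4GenFunBounds.schemeZ ((datumOfRecord₁₃CoPH F N θ hP).scheme g₀) os ((cr F θ hP g₀ os).K₀ + K + 1) t =
              ∑ τ ∈ (cr F θ hP g₀ os).T K, (cr F θ hP g₀ os).B K t τ))
    (h19 : ∀ (F : T4Family) (θ : Stage13HParams F N) (hP : θ.Provisos₁₃CoPH F N), Rg F θ → θ.Admissible F N → ∀ (g₀ : ℕ → ℝ) (os : List (ULoop F)),
      (∀ k : ℕ, RatesHolderAt (datumOfRecord₁₃CoPH F N θ hP) (rateCarriersOfRecord₁₃CoPH (readingOfRecord₁₃CoPH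
        (fun F θ => ReadingData.ofRecordAdm F θ.τ9.M N (S F θ) (fun (k j : ℕ) (_ : (domSys (F.P k) θ.τ9.M j).Dom) => ofBackgroundC (ιSU N) '' {V : GaugeField (F.P k) 0 (Node00.SU N) |
          PlaqSmall (min ((F.L : ℝ) ^ 2 * ((F.L : ℝ) ^ 2 - 1) / (4 * (143 * ((16 : ℝ) * (F.L : ℝ) ^ 2) ^ 2))) (deltaSU (Fin N) / 2 / (32 * (F.L : ℝ) ^ 2)) * F.eps k ^ 2
            * (1 + 4 * (143 * ((16 : ℝ) * (F.L : ℝ) ^ 2) ^ 2) * min ((F.L : ℝ) ^ 2 * ((F.L : ℝ) ^ 2 - 1) / (4 * (143 * ((16 : ℝ) * (F.L : ℝ) ^ 2) ^ 2))) (deltaSU (Fin N) / 2 / (32 * (F.L : ℝ) ^ 2))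
              / ((F.L : ℝ) ^ 2 * ((F.L : ℝ) ^ 2 - 1)) * F.eps k ^ 2)) V})
        (gauge F θ) (hg F θ) (fun k => transportRaw F k (avOfRecord F N (k + 1) 0)) (admTransport_plaqEnvelope_alphaL F θ.toStage13Params.toStage12Params) (li F θ)) ℓ₃ ne2 ne1) F θ hP g₀ os k) β) →
        letI := (cr F θ hP g₀ os).dec
        ∃ δ : ℕ → ℝ, NE7.Core (cr F θ hP g₀ os).l₀ (cr F θ hP g₀ os).vol (cr F θ hP g₀ os).T (cr F θ hP g₀ os).Bad
          (fun K t τ => (cr F θ hP g₀ os).A K t τ - (cr F θ hP g₀ os).shA K t τ) (fun K t τ => (cr F θ hP g₀ os).B K t τ - (cr F θ hP g₀ os).shB K t τ) δ ∧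
          Summable δ) :
    Spine (N := N) fun F D w => Node00.IsRecordOfRecord₁₃CCoPHOn F N Rg D w :=
  have h18' : S_N18 (RRec₁₃CoPHOn (readingOfRecord₁₃CoPH (fun F θ => ReadingData.ofRecordAdm F θ.τ9.M N (S F θ) (fun (k j : ℕ) (_ : (domSys (F.P k) θ.τ9.M j).Dom) => ofBackgroundC (ιSU N) '' {V : GaugeField (F.P k) 0 (Node00.SU N) |
          PlaqSmall (min ((F.L : ℝ) ^ 2 * ((F.L : ℝ) ^ 2 - 1) / (4 * (143 * ((16 : ℝ) * (F.L : ℝ) ^ 2) ^ 2))) (deltaSU (Fin N) / 2 / (32 * (F.L : ℝ) ^ 2)) * F.eps k ^ 2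
            * (1 + 4 * (143 * ((16 : ℝ) * (F.L : ℝ) ^ 2) ^ 2) * min ((F.L : ℝ) ^ 2 * ((F.L : ℝ) ^ 2 - 1) / (4 * (143 * ((16 : ℝ) * (F.L : ℝ) ^ 2) ^ 2))) (deltaSU (Fin N) / 2 / (32 * (F.L : ℝ) ^ 2))
              / ((F.L : ℝ) ^ 2 * ((F.L : ℝ) ^ 2 - 1)) * F.eps k ^ 2)) V})
        (gauge F θ) (hg F θ) (fun k => transportRaw F k (avOfRecord F N (k + 1) 0)) (admTransport_plaqEnvelope_alphaL F θ.toStage13Params.toStage12Params) (li F θ)) ℓ₃ ne2 ne1) Rg) :=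
    (s_N18_readingOfRecord₁₃CoPHOn_iff _ ℓ₃ ne2 ne1 Rg).mpr fun F θ hP hRg hθ k =>
      (n18At_u3OfRecord₁₃_readingAdm_iff θ.toStage13Params k (S F θ) (fun (k j : ℕ) (_ : (domSys (F.P k) θ.τ9.M j).Dom) => ofBackgroundC (ιSU N) '' {V : GaugeField (F.P k) 0 (Node00.SU N) |
          PlaqSmall (min ((F.L : ℝ) ^ 2 * ((F.L : ℝ) ^ 2 - 1) / (4 * (143 * ((16 : ℝ) * (F.L : ℝ) ^ 2) ^ 2))) (deltaSU (Fin N) / 2 / (32 * (F.L : ℝ) ^ 2)) * F.eps k ^ 2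
            * (1 + 4 * (143 * ((16 : ℝ) * (F.L : ℝ) ^ 2) ^ 2) * min ((F.L : ℝ) ^ 2 * ((F.L : ℝ) ^ 2 - 1) / (4 * (143 * ((16 : ℝ) * (F.L : ℝ) ^ 2) ^ 2))) (deltaSU (Fin N) / 2 / (32 * (F.L : ℝ) ^ 2))
              / ((F.L : ℝ) ^ 2 * ((F.L : ℝ) ^ 2 - 1)) * F.eps k ^ 2)) V})
        (gauge F θ) (hg F θ) (fun k => transportRaw F k (avOfRecord F N (k + 1) 0)) (admTransport_plaqEnvelope_alphaL F θ.toStage13Params.toStage12Params) (li F θ)).mpr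
        fun b hb hbγ g hgW U X => h18 F θ hP hRg hθ k b hb hbγ g hgW U.1
          ((mem_image_ofBackgroundC_iff _ U.1).1 (U.2 0 (cubeDom (F.P (k + 1)) θ.τ9.M 0 fun _ => 0))) X
  spine_rec13CCoPHOn_at_readingOfRecord₁₃CoPH_holder cr β _ ne2 ne1 Rg ℓ₃
    ((s_N14_rRec₁₃CoPHOn_iff _ Rg).mpr fun F θ hP hRg hθ g₀ os => h14 F θ hP hRg hθ g₀ os)
    ((s_N15_rRec₁₃CoPHOn_iff _ Rg).mpr fun F θ hP hRg hθ g₀ os k => h15 F θ hP hRg hθ g₀ os k)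
    (s_N16Holder_readingOfRecord₁₃CoPHOn_of_leafSlotHolderAT (Rg := Rg)
      (w1 := fun F θ => ReadingData.ofRecordAdm F θ.τ9.M N (S F θ) (fun (k j : ℕ) (_ : (domSys (F.P k) θ.τ9.M j).Dom) => ofBackgroundC (ιSU N) '' {V : GaugeField (F.P k) 0 (Node00.SU N) |
          PlaqSmall (min ((F.L : ℝ) ^ 2 * ((F.L : ℝ) ^ 2 - 1) / (4 * (143 * ((16 : ℝ) * (F.L : ℝ) ^ 2) ^ 2))) (deltaSU (Fin N) / 2 / (32 * (F.L : ℝ) ^ 2)) * F.eps k ^ 2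
            * (1 + 4 * (143 * ((16 : ℝ) * (F.L : ℝ) ^ 2) ^ 2) * min ((F.L : ℝ) ^ 2 * ((F.L : ℝ) ^ 2 - 1) / (4 * (143 * ((16 : ℝ) * (F.L : ℝ) ^ 2) ^ 2))) (deltaSU (Fin N) / 2 / (32 * (F.L : ℝ) ^ 2))
              / ((F.L : ℝ) ^ 2 * ((F.L : ℝ) ^ 2 - 1)) * F.eps k ^ 2)) V})
        (gauge F θ) (hg F θ) (fun k => transportRaw F k (avOfRecord F N (k + 1) 0)) (admTransport_plaqEnvelope_alphaL F θ.toStage13Params.toStage12Params) (li F θ))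
      (ℓ₃ := ℓ₃) (ne2 := ne2) (ne1 := ne1) hβ0 hβ1 h16)
    h18' (s_N22_readingOfRecord₁₃CoPHOn_ofRecordAdm_of_s_N18_stripBound S (fun F θ (k j : ℕ) (_ : (domSys (F.P k) θ.τ9.M j).Dom) => ofBackgroundC (ιSU N) '' {V : GaugeField (F.P k) 0 (Node00.SU N) |
          PlaqSmall (min ((F.L : ℝ) ^ 2 * ((F.L : ℝ) ^ 2 - 1) / (4 * (143 * ((16 : ℝ) * (F.L : ℝ) ^ 2) ^ 2))) (deltaSU (Fin N) / 2 / (32 * (F.L : ℝ) ^ 2)) * F.eps k ^ 2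
            * (1 + 4 * (143 * ((16 : ℝ) * (F.L : ℝ) ^ 2) ^ 2) * min ((F.L : ℝ) ^ 2 * ((F.L : ℝ) ^ 2 - 1) / (4 * (143 * ((16 : ℝ) * (F.L : ℝ) ^ 2) ^ 2))) (deltaSU (Fin N) / 2 / (32 * (F.L : ℝ) ^ 2))
              / ((F.L : ℝ) ^ 2 * ((F.L : ℝ) ^ 2 - 1)) * F.eps k ^ 2)) V})
      gauge hg (fun F _ k => transportRaw F k (avOfRecord F N (k + 1) 0)) (fun F θ => admTransport_plaqEnvelope_alphaL F θ.toStage13Params.toStage12Params) li ℓ₃ ne2 ne1 Rg h18' hjunk hnum hstrip)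
    ((s_D4_rRec₁₃CoPHOn_iff _ Rg).mpr fun F θ hP hRg hθ _ _ k => hD4 F θ hP hRg hθ k) h20 h21 hx h19

end Regime

end Summit.QuantumFields.YangMills.Theorems.BalabanUVNodesN27SpineRecord

end
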